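import Mathlib.Analysis.SpecialFunctions.Pow.Real

/-!
# `BalabanUV.Beta.D1BFx.CoframeMassAlgebra` — road «BF-x» for binder row D1, slot (K), (II)-row (C2) «TB4-W CO-FRAME TABLE, m-UNIFORM MASS»,
# FILE δ4a «COFRAME ALGEBRA»: **THE (C2) BOUND POLYNOMIAL IS n-UNIFORM ON THE ROAD's SCALING** — pure real arithmetic, no kernels

HONEST DEPENDENCY (cell records, verbatim): «continuum YM on T⁴ ⇐ BetaPertH ∧ nine spine estimates (0/9 proved); BetaPertH ⇐ (D1) ∧ (D4) ∧
CAP+tail; G-an2-4 gates asym, D1 and NE2/3/4.»  HONEST FRAMING (cell contract, verbatim): «discharging `BetaPertH` makes Bałaban's UV stability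
UNCONDITIONAL — a real constructive-QFT result; it is NOT the continuum limit and NOT the Clay problem.»  THIS MODULE DISCHARGES NOTHING of the
wall: [folklore] real arithmetic (`gcongr`, `ring`, `positivity`) on the explicit polynomial of δ3b's `totMass_cofPairInf`.  No definition, no `def … : Prop`, nothing cited, 0 sorry.  0 root-level binders of row D1 discharged (hW ∕ hR-sockets ∕
hSX-socket ∕ D1Tel ∕ D1Rep = 0); (K) NOT closed; (C1)(C2) NOT closed here; NOT D1, NOT `BetaPertH`, NOT continuum, NOT Clay.

ABSOLUTE RULE (cell charter, verbatim): «No internally-minted statement may enter as a cited fact. Every hypothesis is either kernel-proved in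
this package or a verbatim quotation of a PUBLISHED theorem with page reference. The manuscript(s) under audit are NOT citable for their own
disputed steps — they are the thing under adjudication; programme-internal (2001/route/tribunal) claims are never citable.»

WHY.  At the road's weights the letters scale as `C = C′ = q⁻⁴·c_E` (amplitude of `colH G₀`, «G0-COL-ENV»), `χ = q²·X` (`lapU∘Cgh`, `Cgh∘lapU`),
`γ = q⁴·G` (`Cgh`), `ψ, r = O(1)`, `Zl 4 (δ−θ) ≤ q⁴·z₁` (`δ − θ ≍ 1∕q`), `q = m + 1`: every monomial of the polynomial carries `C·C′·Zl = q⁻⁴·(…)`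
against at most `q⁴` from its legs, so the whole bound is `≤ K·S` with `K` free of `q` — the m-UNIFORMITY of the (C2) letter.

CONTENT (all [folklore]; atoms as squares so that `positivity` sees their signs).
* `m1 … m17`: one lemma per distinct monomial, `M(q) ≤ M⋆·S` (`gcongr` on `Z ≤ q⁴z₁`, `e^δ ≤ E_δ`, `e^θ ≤ E_θ`; `ring`; `q^{a} ≤ q⁸` for `a ≤ 8`).
* **`poly_bound`**: `c_E = q⁴·C`, `χ = q²·X`, `γ = q⁴·G`, `1 ≤ q` ⟹ `|2|·P(q) ≤ (|2|·P⋆)·S`.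
NOT HERE: kernels (δ3b), the road instantiation (δ4b `CoframeMassUniform`).
Unit `b2b-balaban-gan24-formalise-leaf-05` (gen 54), G-an2-4 swarm leaf prover 05, road «BF-x» (C1)(C2) count owner (OWNER RULING ρ-g19-1 AMENDED l.43347,
ρ-g19-2: the END's currency is the subsequence `n = L^k`); INTENT «COFRAME WORDS ∕ UNIFORM» (journal).
-/

namespace Summit.QuantumFields.BalabanUV.Beta.D1BFx.CoframeMassAlgebra

/-- [folklore] monomial 1 of the (C2) polynomial: `q`-degree `-2`. -/
theorem m1 (sq sC sX sZ sS sz : ℝ) (hq : 1 ≤ sq ^ 2) (hZ : sZ ^ 2 ≤ (sq ^ 2) ^ 4 * sz ^ 2) :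
    64 * (((sq ^ 2) ^ 2 * (sX ^ 2)) * (8 * (((sC ^ 2) * (sC ^ 2)) * (sZ ^ 2) * (sS ^ 2))))
      ≤ (64 * ((sX ^ 2) * (8 * (((sq ^ 2) ^ 4 * (sC ^ 2) * ((sq ^ 2) ^ 4 * (sC ^ 2))) * (sz ^ 2) * 1)))) * (sS ^ 2) := by
  calc 64 * (((sq ^ 2) ^ 2 * (sX ^ 2)) * (8 * (((sC ^ 2) * (sC ^ 2)) * (sZ ^ 2) * (sS ^ 2))))
      ≤ 64 * (((sq ^ 2) ^ 2 * (sX ^ 2)) * (8 * (((sC ^ 2) * (sC ^ 2)) * ((sq ^ 2) ^ 4 * (sz ^ 2)) * (sS ^ 2)))) := by gcongr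
    _ = (sq ^ 2) ^ 6 * (64 * ((sX ^ 2) * (8 * (((sC ^ 2) * (sC ^ 2)) * (sz ^ 2) * (sS ^ 2))))) := by ring
    _ ≤ (sq ^ 2) ^ 8 * (64 * ((sX ^ 2) * (8 * (((sC ^ 2) * (sC ^ 2)) * (sz ^ 2) * (sS ^ 2))))) := mul_le_mul_of_nonneg_right (pow_le_pow_right₀ hq (by norm_num)) (by positivity)
    _ = (64 * ((sX ^ 2) * (8 * (((sq ^ 2) ^ 4 * (sC ^ 2) * ((sq ^ 2) ^ 4 * (sC ^ 2))) * (sz ^ 2) * 1)))) * (sS ^ 2) := by ring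

/-- [folklore] monomial 2 of the (C2) polynomial: `q`-degree `-2`. -/
theorem m2 (sq sC sX se sZ sS sz sE : ℝ) (hq : 1 ≤ sq ^ 2) (heδE : se ^ 2 ≤ sE ^ 2) (hZ : sZ ^ 2 ≤ (sq ^ 2) ^ 4 * sz ^ 2) :
    32 * (((sq ^ 2) ^ 2 * (sX ^ 2)) * (8 * (sC ^ 2) * (se ^ 2)) * (se ^ 2) * (sC ^ 2) * (sZ ^ 2) * (sS ^ 2))
      ≤ (32 * ((sX ^ 2) * (8 * ((sq ^ 2) ^ 4 * (sC ^ 2)) * (sE ^ 2)) * (sE ^ 2) * ((sq ^ 2) ^ 4 * (sC ^ 2)) * (sz ^ 2) * 1)) * (sS ^ 2) := by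
  calc 32 * (((sq ^ 2) ^ 2 * (sX ^ 2)) * (8 * (sC ^ 2) * (se ^ 2)) * (se ^ 2) * (sC ^ 2) * (sZ ^ 2) * (sS ^ 2))
      ≤ 32 * (((sq ^ 2) ^ 2 * (sX ^ 2)) * (8 * (sC ^ 2) * (sE ^ 2)) * (sE ^ 2) * (sC ^ 2) * ((sq ^ 2) ^ 4 * (sz ^ 2)) * (sS ^ 2)) := by gcongr
    _ = (sq ^ 2) ^ 6 * (32 * ((sX ^ 2) * (8 * (sC ^ 2) * (sE ^ 2)) * (sE ^ 2) * (sC ^ 2) * (sz ^ 2) * (sS ^ 2))) := by ring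
    _ ≤ (sq ^ 2) ^ 8 * (32 * ((sX ^ 2) * (8 * (sC ^ 2) * (sE ^ 2)) * (sE ^ 2) * (sC ^ 2) * (sz ^ 2) * (sS ^ 2))) := mul_le_mul_of_nonneg_right (pow_le_pow_right₀ hq (by norm_num)) (by positivity)
    _ = (32 * ((sX ^ 2) * (8 * ((sq ^ 2) ^ 4 * (sC ^ 2)) * (sE ^ 2)) * (sE ^ 2) * ((sq ^ 2) ^ 4 * (sC ^ 2)) * (sz ^ 2) * 1)) * (sS ^ 2) := by ring

/-- [folklore] monomial 3 of the (C2) polynomial: `q`-degree `-4`. -/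
theorem m3 (sq sC sr sZ sS sz : ℝ) (hq : 1 ≤ sq ^ 2) (hZ : sZ ^ 2 ≤ (sq ^ 2) ^ 4 * sz ^ 2) :
    32 * ((sr ^ 2) * (((sC ^ 2) * (sC ^ 2)) * (sZ ^ 2) * (sS ^ 2)))
      ≤ (32 * ((sr ^ 2) * (((sq ^ 2) ^ 4 * (sC ^ 2) * ((sq ^ 2) ^ 4 * (sC ^ 2))) * (sz ^ 2) * 1))) * (sS ^ 2) := by
  calc 32 * ((sr ^ 2) * (((sC ^ 2) * (sC ^ 2)) * (sZ ^ 2) * (sS ^ 2)))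
      ≤ 32 * ((sr ^ 2) * (((sC ^ 2) * (sC ^ 2)) * ((sq ^ 2) ^ 4 * (sz ^ 2)) * (sS ^ 2))) := by gcongr
    _ = (sq ^ 2) ^ 4 * (32 * ((sr ^ 2) * (((sC ^ 2) * (sC ^ 2)) * (sz ^ 2) * (sS ^ 2)))) := by ring
    _ ≤ (sq ^ 2) ^ 8 * (32 * ((sr ^ 2) * (((sC ^ 2) * (sC ^ 2)) * (sz ^ 2) * (sS ^ 2)))) := mul_le_mul_of_nonneg_right (pow_le_pow_right₀ hq (by norm_num)) (by positivity)
    _ = (32 * ((sr ^ 2) * (((sq ^ 2) ^ 4 * (sC ^ 2) * ((sq ^ 2) ^ 4 * (sC ^ 2))) * (sz ^ 2) * 1))) * (sS ^ 2) := by ring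

/-- [folklore] monomial 4 of the (C2) polynomial: `q`-degree `0`. -/
theorem m4 (sq sC sX se sZ sS sz sE : ℝ) (heδE : se ^ 2 ≤ sE ^ 2) (hZ : sZ ^ 2 ≤ (sq ^ 2) ^ 4 * sz ^ 2) :
    64 * ((((sq ^ 2) ^ 2 * (sX ^ 2)) * (8 * (sC ^ 2) * (se ^ 2))) * (8 * (sC ^ 2) * (se ^ 2)) * ((sq ^ 2) ^ 2 * (sX ^ 2)) * (sZ ^ 2) * (sS ^ 2))
      ≤ (64 * (((sX ^ 2) * (8 * ((sq ^ 2) ^ 4 * (sC ^ 2)) * (sE ^ 2))) * (8 * ((sq ^ 2) ^ 4 * (sC ^ 2)) * (sE ^ 2)) * (sX ^ 2) * (sz ^ 2) * 1)) * (sS ^ 2) := by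
  calc 64 * ((((sq ^ 2) ^ 2 * (sX ^ 2)) * (8 * (sC ^ 2) * (se ^ 2))) * (8 * (sC ^ 2) * (se ^ 2)) * ((sq ^ 2) ^ 2 * (sX ^ 2)) * (sZ ^ 2) * (sS ^ 2))
      ≤ 64 * ((((sq ^ 2) ^ 2 * (sX ^ 2)) * (8 * (sC ^ 2) * (sE ^ 2))) * (8 * (sC ^ 2) * (sE ^ 2)) * ((sq ^ 2) ^ 2 * (sX ^ 2)) * ((sq ^ 2) ^ 4 * (sz ^ 2)) * (sS ^ 2)) := by gcongr
    _ = (64 * (((sX ^ 2) * (8 * ((sq ^ 2) ^ 4 * (sC ^ 2)) * (sE ^ 2))) * (8 * ((sq ^ 2) ^ 4 * (sC ^ 2)) * (sE ^ 2)) * (sX ^ 2) * (sz ^ 2) * 1)) * (sS ^ 2) := by ring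

/-- [folklore] monomial 5 of the (C2) polynomial: `q`-degree `0`. -/
theorem m5 (sq sC sG sP se sZ sS sz sE : ℝ) (heδE : se ^ 2 ≤ sE ^ 2) (hZ : sZ ^ 2 ≤ (sq ^ 2) ^ 4 * sz ^ 2) :
    64 * (((sP ^ 2) * (8 * (sC ^ 2) * (se ^ 2))) * (8 * (sC ^ 2) * (se ^ 2)) * ((sq ^ 2) ^ 4 * (sG ^ 2)) * (sZ ^ 2) * (sS ^ 2))
      ≤ (64 * (((sP ^ 2) * (8 * ((sq ^ 2) ^ 4 * (sC ^ 2)) * (sE ^ 2))) * (8 * ((sq ^ 2) ^ 4 * (sC ^ 2)) * (sE ^ 2)) * (sG ^ 2) * (sz ^ 2) * 1)) * (sS ^ 2) := by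
  calc 64 * (((sP ^ 2) * (8 * (sC ^ 2) * (se ^ 2))) * (8 * (sC ^ 2) * (se ^ 2)) * ((sq ^ 2) ^ 4 * (sG ^ 2)) * (sZ ^ 2) * (sS ^ 2))
      ≤ 64 * (((sP ^ 2) * (8 * (sC ^ 2) * (sE ^ 2))) * (8 * (sC ^ 2) * (sE ^ 2)) * ((sq ^ 2) ^ 4 * (sG ^ 2)) * ((sq ^ 2) ^ 4 * (sz ^ 2)) * (sS ^ 2)) := by gcongr
    _ = (64 * (((sP ^ 2) * (8 * ((sq ^ 2) ^ 4 * (sC ^ 2)) * (sE ^ 2))) * (8 * ((sq ^ 2) ^ 4 * (sC ^ 2)) * (sE ^ 2)) * (sG ^ 2) * (sz ^ 2) * 1)) * (sS ^ 2) := by ring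

/-- [folklore] monomial 6 of the (C2) polynomial: `q`-degree `-2`. -/
theorem m6 (sq sC sX sP se st sZ sS sz sE sT : ℝ) (hq : 1 ≤ sq ^ 2) (heδE : se ^ 2 ≤ sE ^ 2) (heθE : st ^ 2 ≤ sT ^ 2) (hZ : sZ ^ 2 ≤ (sq ^ 2) ^ 4 * sz ^ 2) :
    32 * ((((sq ^ 2) ^ 2 * (sX ^ 2)) * (8 * (sC ^ 2) * (se ^ 2))) * (sC ^ 2) * ((st ^ 2) * (sP ^ 2)) * (sZ ^ 2) * (sS ^ 2))
      ≤ (32 * (((sX ^ 2) * (8 * ((sq ^ 2) ^ 4 * (sC ^ 2)) * (sE ^ 2))) * ((sq ^ 2) ^ 4 * (sC ^ 2)) * ((sT ^ 2) * (sP ^ 2)) * (sz ^ 2) * 1)) * (sS ^ 2) := by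
  calc 32 * ((((sq ^ 2) ^ 2 * (sX ^ 2)) * (8 * (sC ^ 2) * (se ^ 2))) * (sC ^ 2) * ((st ^ 2) * (sP ^ 2)) * (sZ ^ 2) * (sS ^ 2))
      ≤ 32 * ((((sq ^ 2) ^ 2 * (sX ^ 2)) * (8 * (sC ^ 2) * (sE ^ 2))) * (sC ^ 2) * ((sT ^ 2) * (sP ^ 2)) * ((sq ^ 2) ^ 4 * (sz ^ 2)) * (sS ^ 2)) := by gcongr
    _ = (sq ^ 2) ^ 6 * (32 * (((sX ^ 2) * (8 * (sC ^ 2) * (sE ^ 2))) * (sC ^ 2) * ((sT ^ 2) * (sP ^ 2)) * (sz ^ 2) * (sS ^ 2))) := by ring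
    _ ≤ (sq ^ 2) ^ 8 * (32 * (((sX ^ 2) * (8 * (sC ^ 2) * (sE ^ 2))) * (sC ^ 2) * ((sT ^ 2) * (sP ^ 2)) * (sz ^ 2) * (sS ^ 2))) := mul_le_mul_of_nonneg_right (pow_le_pow_right₀ hq (by norm_num)) (by positivity)
    _ = (32 * (((sX ^ 2) * (8 * ((sq ^ 2) ^ 4 * (sC ^ 2)) * (sE ^ 2))) * ((sq ^ 2) ^ 4 * (sC ^ 2)) * ((sT ^ 2) * (sP ^ 2)) * (sz ^ 2) * 1)) * (sS ^ 2) := by ring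

/-- [folklore] monomial 7 of the (C2) polynomial: `q`-degree `-2`. -/
theorem m7 (sq sC sX sP se st sZ sS sz sE sT : ℝ) (hq : 1 ≤ sq ^ 2) (heδE : se ^ 2 ≤ sE ^ 2) (heθE : st ^ 2 ≤ sT ^ 2) (hZ : sZ ^ 2 ≤ (sq ^ 2) ^ 4 * sz ^ 2) :
    32 * (((sP ^ 2) * (8 * (sC ^ 2) * (se ^ 2))) * (sC ^ 2) * ((st ^ 2) * ((sq ^ 2) ^ 2 * (sX ^ 2))) * (sZ ^ 2) * (sS ^ 2))
      ≤ (32 * (((sP ^ 2) * (8 * ((sq ^ 2) ^ 4 * (sC ^ 2)) * (sE ^ 2))) * ((sq ^ 2) ^ 4 * (sC ^ 2)) * ((sT ^ 2) * (sX ^ 2)) * (sz ^ 2) * 1)) * (sS ^ 2) := by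
  calc 32 * (((sP ^ 2) * (8 * (sC ^ 2) * (se ^ 2))) * (sC ^ 2) * ((st ^ 2) * ((sq ^ 2) ^ 2 * (sX ^ 2))) * (sZ ^ 2) * (sS ^ 2))
      ≤ 32 * (((sP ^ 2) * (8 * (sC ^ 2) * (sE ^ 2))) * (sC ^ 2) * ((sT ^ 2) * ((sq ^ 2) ^ 2 * (sX ^ 2))) * ((sq ^ 2) ^ 4 * (sz ^ 2)) * (sS ^ 2)) := by gcongr
    _ = (sq ^ 2) ^ 6 * (32 * (((sP ^ 2) * (8 * (sC ^ 2) * (sE ^ 2))) * (sC ^ 2) * ((sT ^ 2) * (sX ^ 2)) * (sz ^ 2) * (sS ^ 2))) := by ring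
    _ ≤ (sq ^ 2) ^ 8 * (32 * (((sP ^ 2) * (8 * (sC ^ 2) * (sE ^ 2))) * (sC ^ 2) * ((sT ^ 2) * (sX ^ 2)) * (sz ^ 2) * (sS ^ 2))) := mul_le_mul_of_nonneg_right (pow_le_pow_right₀ hq (by norm_num)) (by positivity)
    _ = (32 * (((sP ^ 2) * (8 * ((sq ^ 2) ^ 4 * (sC ^ 2)) * (sE ^ 2))) * ((sq ^ 2) ^ 4 * (sC ^ 2)) * ((sT ^ 2) * (sX ^ 2)) * (sz ^ 2) * 1)) * (sS ^ 2) := by ring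

/-- [folklore] monomial 8 of the (C2) polynomial: `q`-degree `-2`. -/
theorem m8 (sq sC sX sP sZ sS sz : ℝ) (hq : 1 ≤ sq ^ 2) (hZ : sZ ^ 2 ≤ (sq ^ 2) ^ 4 * sz ^ 2) :
    ((sq ^ 2) ^ 2 * (sX ^ 2)) * (8 * (((sC ^ 2) * (sC ^ 2)) * (sZ ^ 2) * (sS ^ 2))) * (sP ^ 2)
      ≤ ((sX ^ 2) * (8 * (((sq ^ 2) ^ 4 * (sC ^ 2) * ((sq ^ 2) ^ 4 * (sC ^ 2))) * (sz ^ 2) * 1)) * (sP ^ 2)) * (sS ^ 2) := by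
  calc ((sq ^ 2) ^ 2 * (sX ^ 2)) * (8 * (((sC ^ 2) * (sC ^ 2)) * (sZ ^ 2) * (sS ^ 2))) * (sP ^ 2)
      ≤ ((sq ^ 2) ^ 2 * (sX ^ 2)) * (8 * (((sC ^ 2) * (sC ^ 2)) * ((sq ^ 2) ^ 4 * (sz ^ 2)) * (sS ^ 2))) * (sP ^ 2) := by gcongr
    _ = (sq ^ 2) ^ 6 * ((sX ^ 2) * (8 * (((sC ^ 2) * (sC ^ 2)) * (sz ^ 2) * (sS ^ 2))) * (sP ^ 2)) := by ring
    _ ≤ (sq ^ 2) ^ 8 * ((sX ^ 2) * (8 * (((sC ^ 2) * (sC ^ 2)) * (sz ^ 2) * (sS ^ 2))) * (sP ^ 2)) := mul_le_mul_of_nonneg_right (pow_le_pow_right₀ hq (by norm_num)) (by positivity)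
    _ = ((sX ^ 2) * (8 * (((sq ^ 2) ^ 4 * (sC ^ 2) * ((sq ^ 2) ^ 4 * (sC ^ 2))) * (sz ^ 2) * 1)) * (sP ^ 2)) * (sS ^ 2) := by ring

/-- [folklore] monomial 9 of the (C2) polynomial: `q`-degree `0`. -/
theorem m9 (sq sC sX se sZ sS sz sE : ℝ) (heδE : se ^ 2 ≤ sE ^ 2) (hZ : sZ ^ 2 ≤ (sq ^ 2) ^ 4 * sz ^ 2) :
    (((sq ^ 2) ^ 2 * (sX ^ 2)) * (8 * (sC ^ 2) * (se ^ 2))) * (8 * (sC ^ 2) * (se ^ 2)) * (sZ ^ 2) * (sS ^ 2) * ((sq ^ 2) ^ 2 * (sX ^ 2))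
      ≤ (((sX ^ 2) * (8 * ((sq ^ 2) ^ 4 * (sC ^ 2)) * (sE ^ 2))) * (8 * ((sq ^ 2) ^ 4 * (sC ^ 2)) * (sE ^ 2)) * (sz ^ 2) * 1 * (sX ^ 2)) * (sS ^ 2) := by
  calc (((sq ^ 2) ^ 2 * (sX ^ 2)) * (8 * (sC ^ 2) * (se ^ 2))) * (8 * (sC ^ 2) * (se ^ 2)) * (sZ ^ 2) * (sS ^ 2) * ((sq ^ 2) ^ 2 * (sX ^ 2))
      ≤ (((sq ^ 2) ^ 2 * (sX ^ 2)) * (8 * (sC ^ 2) * (sE ^ 2))) * (8 * (sC ^ 2) * (sE ^ 2)) * ((sq ^ 2) ^ 4 * (sz ^ 2)) * (sS ^ 2) * ((sq ^ 2) ^ 2 * (sX ^ 2)) := by gcongr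
    _ = (((sX ^ 2) * (8 * ((sq ^ 2) ^ 4 * (sC ^ 2)) * (sE ^ 2))) * (8 * ((sq ^ 2) ^ 4 * (sC ^ 2)) * (sE ^ 2)) * (sz ^ 2) * 1 * (sX ^ 2)) * (sS ^ 2) := by ring

/-- [folklore] monomial 10 of the (C2) polynomial: `q`-degree `-2`. -/
theorem m10 (sq sC sX sP sZ sS sz : ℝ) (hq : 1 ≤ sq ^ 2) (hZ : sZ ^ 2 ≤ (sq ^ 2) ^ 4 * sz ^ 2) :
    (sP ^ 2) * (8 * (((sC ^ 2) * (sC ^ 2)) * (sZ ^ 2) * (sS ^ 2))) * ((sq ^ 2) ^ 2 * (sX ^ 2))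
      ≤ ((sP ^ 2) * (8 * (((sq ^ 2) ^ 4 * (sC ^ 2) * ((sq ^ 2) ^ 4 * (sC ^ 2))) * (sz ^ 2) * 1)) * (sX ^ 2)) * (sS ^ 2) := by
  calc (sP ^ 2) * (8 * (((sC ^ 2) * (sC ^ 2)) * (sZ ^ 2) * (sS ^ 2))) * ((sq ^ 2) ^ 2 * (sX ^ 2))
      ≤ (sP ^ 2) * (8 * (((sC ^ 2) * (sC ^ 2)) * ((sq ^ 2) ^ 4 * (sz ^ 2)) * (sS ^ 2))) * ((sq ^ 2) ^ 2 * (sX ^ 2)) := by gcongr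
    _ = (sq ^ 2) ^ 6 * ((sP ^ 2) * (8 * (((sC ^ 2) * (sC ^ 2)) * (sz ^ 2) * (sS ^ 2))) * (sX ^ 2)) := by ring
    _ ≤ (sq ^ 2) ^ 8 * ((sP ^ 2) * (8 * (((sC ^ 2) * (sC ^ 2)) * (sz ^ 2) * (sS ^ 2))) * (sX ^ 2)) := mul_le_mul_of_nonneg_right (pow_le_pow_right₀ hq (by norm_num)) (by positivity)
    _ = ((sP ^ 2) * (8 * (((sq ^ 2) ^ 4 * (sC ^ 2) * ((sq ^ 2) ^ 4 * (sC ^ 2))) * (sz ^ 2) * 1)) * (sX ^ 2)) * (sS ^ 2) := by ring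

/-- [folklore] monomial 11 of the (C2) polynomial: `q`-degree `0`. -/
theorem m11 (sq sC sX sP se sZ sS sz sE : ℝ) (heδE : se ^ 2 ≤ sE ^ 2) (hZ : sZ ^ 2 ≤ (sq ^ 2) ^ 4 * sz ^ 2) :
    (((sq ^ 2) ^ 2 * (sX ^ 2)) * (8 * (sC ^ 2) * (se ^ 2))) * (8 * (sC ^ 2) * (se ^ 2)) * ((sq ^ 2) ^ 2 * (sX ^ 2)) * (sZ ^ 2) * (sS ^ 2) * (sP ^ 2)
      ≤ (((sX ^ 2) * (8 * ((sq ^ 2) ^ 4 * (sC ^ 2)) * (sE ^ 2))) * (8 * ((sq ^ 2) ^ 4 * (sC ^ 2)) * (sE ^ 2)) * (sX ^ 2) * (sz ^ 2) * 1 * (sP ^ 2)) * (sS ^ 2) := by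
  calc (((sq ^ 2) ^ 2 * (sX ^ 2)) * (8 * (sC ^ 2) * (se ^ 2))) * (8 * (sC ^ 2) * (se ^ 2)) * ((sq ^ 2) ^ 2 * (sX ^ 2)) * (sZ ^ 2) * (sS ^ 2) * (sP ^ 2)
      ≤ (((sq ^ 2) ^ 2 * (sX ^ 2)) * (8 * (sC ^ 2) * (sE ^ 2))) * (8 * (sC ^ 2) * (sE ^ 2)) * ((sq ^ 2) ^ 2 * (sX ^ 2)) * ((sq ^ 2) ^ 4 * (sz ^ 2)) * (sS ^ 2) * (sP ^ 2) := by gcongr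
    _ = (((sX ^ 2) * (8 * ((sq ^ 2) ^ 4 * (sC ^ 2)) * (sE ^ 2))) * (8 * ((sq ^ 2) ^ 4 * (sC ^ 2)) * (sE ^ 2)) * (sX ^ 2) * (sz ^ 2) * 1 * (sP ^ 2)) * (sS ^ 2) := by ring

/-- [folklore] monomial 12 of the (C2) polynomial: `q`-degree `0`. -/
theorem m12 (sq sC sX sP se sZ sS sz sE : ℝ) (heδE : se ^ 2 ≤ sE ^ 2) (hZ : sZ ^ 2 ≤ (sq ^ 2) ^ 4 * sz ^ 2) :
    (((sq ^ 2) ^ 2 * (sX ^ 2)) * (8 * (sC ^ 2) * (se ^ 2))) * (8 * (sC ^ 2) * (se ^ 2)) * (sP ^ 2) * (sZ ^ 2) * (sS ^ 2) * ((sq ^ 2) ^ 2 * (sX ^ 2))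
      ≤ (((sX ^ 2) * (8 * ((sq ^ 2) ^ 4 * (sC ^ 2)) * (sE ^ 2))) * (8 * ((sq ^ 2) ^ 4 * (sC ^ 2)) * (sE ^ 2)) * (sP ^ 2) * (sz ^ 2) * 1 * (sX ^ 2)) * (sS ^ 2) := by
  calc (((sq ^ 2) ^ 2 * (sX ^ 2)) * (8 * (sC ^ 2) * (se ^ 2))) * (8 * (sC ^ 2) * (se ^ 2)) * (sP ^ 2) * (sZ ^ 2) * (sS ^ 2) * ((sq ^ 2) ^ 2 * (sX ^ 2))
      ≤ (((sq ^ 2) ^ 2 * (sX ^ 2)) * (8 * (sC ^ 2) * (sE ^ 2))) * (8 * (sC ^ 2) * (sE ^ 2)) * (sP ^ 2) * ((sq ^ 2) ^ 4 * (sz ^ 2)) * (sS ^ 2) * ((sq ^ 2) ^ 2 * (sX ^ 2)) := by gcongr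
    _ = (((sX ^ 2) * (8 * ((sq ^ 2) ^ 4 * (sC ^ 2)) * (sE ^ 2))) * (8 * ((sq ^ 2) ^ 4 * (sC ^ 2)) * (sE ^ 2)) * (sP ^ 2) * (sz ^ 2) * 1 * (sX ^ 2)) * (sS ^ 2) := by ring

/-- [folklore] monomial 13 of the (C2) polynomial: `q`-degree `0`. -/
theorem m13 (sq sC sG sP se sZ sS sz sE : ℝ) (heδE : se ^ 2 ≤ sE ^ 2) (hZ : sZ ^ 2 ≤ (sq ^ 2) ^ 4 * sz ^ 2) :
    ((sP ^ 2) * (8 * (sC ^ 2) * (se ^ 2))) * (8 * (sC ^ 2) * (se ^ 2)) * ((sq ^ 2) ^ 4 * (sG ^ 2)) * (sZ ^ 2) * (sS ^ 2) * (sP ^ 2)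
      ≤ (((sP ^ 2) * (8 * ((sq ^ 2) ^ 4 * (sC ^ 2)) * (sE ^ 2))) * (8 * ((sq ^ 2) ^ 4 * (sC ^ 2)) * (sE ^ 2)) * (sG ^ 2) * (sz ^ 2) * 1 * (sP ^ 2)) * (sS ^ 2) := by
  calc ((sP ^ 2) * (8 * (sC ^ 2) * (se ^ 2))) * (8 * (sC ^ 2) * (se ^ 2)) * ((sq ^ 2) ^ 4 * (sG ^ 2)) * (sZ ^ 2) * (sS ^ 2) * (sP ^ 2)
      ≤ ((sP ^ 2) * (8 * (sC ^ 2) * (sE ^ 2))) * (8 * (sC ^ 2) * (sE ^ 2)) * ((sq ^ 2) ^ 4 * (sG ^ 2)) * ((sq ^ 2) ^ 4 * (sz ^ 2)) * (sS ^ 2) * (sP ^ 2) := by gcongr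
    _ = (((sP ^ 2) * (8 * ((sq ^ 2) ^ 4 * (sC ^ 2)) * (sE ^ 2))) * (8 * ((sq ^ 2) ^ 4 * (sC ^ 2)) * (sE ^ 2)) * (sG ^ 2) * (sz ^ 2) * 1 * (sP ^ 2)) * (sS ^ 2) := by ring

/-- [folklore] monomial 14 of the (C2) polynomial: `q`-degree `0`. -/
theorem m14 (sq sC sX sP se sZ sS sz sE : ℝ) (heδE : se ^ 2 ≤ sE ^ 2) (hZ : sZ ^ 2 ≤ (sq ^ 2) ^ 4 * sz ^ 2) :
    ((sP ^ 2) * (8 * (sC ^ 2) * (se ^ 2))) * (8 * (sC ^ 2) * (se ^ 2)) * ((sq ^ 2) ^ 2 * (sX ^ 2)) * (sZ ^ 2) * (sS ^ 2) * ((sq ^ 2) ^ 2 * (sX ^ 2))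
      ≤ (((sP ^ 2) * (8 * ((sq ^ 2) ^ 4 * (sC ^ 2)) * (sE ^ 2))) * (8 * ((sq ^ 2) ^ 4 * (sC ^ 2)) * (sE ^ 2)) * (sX ^ 2) * (sz ^ 2) * 1 * (sX ^ 2)) * (sS ^ 2) := by
  calc ((sP ^ 2) * (8 * (sC ^ 2) * (se ^ 2))) * (8 * (sC ^ 2) * (se ^ 2)) * ((sq ^ 2) ^ 2 * (sX ^ 2)) * (sZ ^ 2) * (sS ^ 2) * ((sq ^ 2) ^ 2 * (sX ^ 2))
      ≤ ((sP ^ 2) * (8 * (sC ^ 2) * (sE ^ 2))) * (8 * (sC ^ 2) * (sE ^ 2)) * ((sq ^ 2) ^ 2 * (sX ^ 2)) * ((sq ^ 2) ^ 4 * (sz ^ 2)) * (sS ^ 2) * ((sq ^ 2) ^ 2 * (sX ^ 2)) := by gcongr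
    _ = (((sP ^ 2) * (8 * ((sq ^ 2) ^ 4 * (sC ^ 2)) * (sE ^ 2))) * (8 * ((sq ^ 2) ^ 4 * (sC ^ 2)) * (sE ^ 2)) * (sX ^ 2) * (sz ^ 2) * 1 * (sX ^ 2)) * (sS ^ 2) := by ring

/-- [folklore] monomial 15 of the (C2) polynomial: `q`-degree `0`. -/
theorem m15 (sq sC sG se sZ sS sz sE : ℝ) (heδE : se ^ 2 ≤ sE ^ 2) (hZ : sZ ^ 2 ≤ (sq ^ 2) ^ 4 * sz ^ 2) :
    64 * ((8 * (sC ^ 2) * (se ^ 2)) * (8 * (sC ^ 2) * (se ^ 2)) * ((sq ^ 2) ^ 4 * (sG ^ 2)) * (sZ ^ 2) * (sS ^ 2))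
      ≤ (64 * ((8 * ((sq ^ 2) ^ 4 * (sC ^ 2)) * (sE ^ 2)) * (8 * ((sq ^ 2) ^ 4 * (sC ^ 2)) * (sE ^ 2)) * (sG ^ 2) * (sz ^ 2) * 1)) * (sS ^ 2) := by
  calc 64 * ((8 * (sC ^ 2) * (se ^ 2)) * (8 * (sC ^ 2) * (se ^ 2)) * ((sq ^ 2) ^ 4 * (sG ^ 2)) * (sZ ^ 2) * (sS ^ 2))
      ≤ 64 * ((8 * (sC ^ 2) * (sE ^ 2)) * (8 * (sC ^ 2) * (sE ^ 2)) * ((sq ^ 2) ^ 4 * (sG ^ 2)) * ((sq ^ 2) ^ 4 * (sz ^ 2)) * (sS ^ 2)) := by gcongr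
    _ = (64 * ((8 * ((sq ^ 2) ^ 4 * (sC ^ 2)) * (sE ^ 2)) * (8 * ((sq ^ 2) ^ 4 * (sC ^ 2)) * (sE ^ 2)) * (sG ^ 2) * (sz ^ 2) * 1)) * (sS ^ 2) := by ring

/-- [folklore] monomial 16 of the (C2) polynomial: `q`-degree `-2`. -/
theorem m16 (sq sC sX se st sZ sS sz sE sT : ℝ) (hq : 1 ≤ sq ^ 2) (heδE : se ^ 2 ≤ sE ^ 2) (heθE : st ^ 2 ≤ sT ^ 2) (hZ : sZ ^ 2 ≤ (sq ^ 2) ^ 4 * sz ^ 2) :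
    32 * ((8 * (sC ^ 2) * (se ^ 2)) * (sC ^ 2) * ((st ^ 2) * ((sq ^ 2) ^ 2 * (sX ^ 2))) * (sZ ^ 2) * (sS ^ 2))
      ≤ (32 * ((8 * ((sq ^ 2) ^ 4 * (sC ^ 2)) * (sE ^ 2)) * ((sq ^ 2) ^ 4 * (sC ^ 2)) * ((sT ^ 2) * (sX ^ 2)) * (sz ^ 2) * 1)) * (sS ^ 2) := by
  calc 32 * ((8 * (sC ^ 2) * (se ^ 2)) * (sC ^ 2) * ((st ^ 2) * ((sq ^ 2) ^ 2 * (sX ^ 2))) * (sZ ^ 2) * (sS ^ 2))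
      ≤ 32 * ((8 * (sC ^ 2) * (sE ^ 2)) * (sC ^ 2) * ((sT ^ 2) * ((sq ^ 2) ^ 2 * (sX ^ 2))) * ((sq ^ 2) ^ 4 * (sz ^ 2)) * (sS ^ 2)) := by gcongr
    _ = (sq ^ 2) ^ 6 * (32 * ((8 * (sC ^ 2) * (sE ^ 2)) * (sC ^ 2) * ((sT ^ 2) * (sX ^ 2)) * (sz ^ 2) * (sS ^ 2))) := by ring
    _ ≤ (sq ^ 2) ^ 8 * (32 * ((8 * (sC ^ 2) * (sE ^ 2)) * (sC ^ 2) * ((sT ^ 2) * (sX ^ 2)) * (sz ^ 2) * (sS ^ 2))) := mul_le_mul_of_nonneg_right (pow_le_pow_right₀ hq (by norm_num)) (by positivity)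
    _ = (32 * ((8 * ((sq ^ 2) ^ 4 * (sC ^ 2)) * (sE ^ 2)) * ((sq ^ 2) ^ 4 * (sC ^ 2)) * ((sT ^ 2) * (sX ^ 2)) * (sz ^ 2) * 1)) * (sS ^ 2) := by ring

/-- [folklore] monomial 17 of the (C2) polynomial: `q`-degree `-4`. -/
theorem m17 (sq sC sr st sZ sS sz sT : ℝ) (hq : 1 ≤ sq ^ 2) (heθE : st ^ 2 ≤ sT ^ 2) (hZ : sZ ^ 2 ≤ (sq ^ 2) ^ 4 * sz ^ 2) :
    16 * ((sC ^ 2) * (sC ^ 2) * ((st ^ 2) * ((st ^ 2) * (sr ^ 2))) * (sZ ^ 2) * (sS ^ 2))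
      ≤ (16 * ((sq ^ 2) ^ 4 * (sC ^ 2) * ((sq ^ 2) ^ 4 * (sC ^ 2)) * ((sT ^ 2) * ((sT ^ 2) * (sr ^ 2))) * (sz ^ 2) * 1)) * (sS ^ 2) := by
  calc 16 * ((sC ^ 2) * (sC ^ 2) * ((st ^ 2) * ((st ^ 2) * (sr ^ 2))) * (sZ ^ 2) * (sS ^ 2))
      ≤ 16 * ((sC ^ 2) * (sC ^ 2) * ((sT ^ 2) * ((sT ^ 2) * (sr ^ 2))) * ((sq ^ 2) ^ 4 * (sz ^ 2)) * (sS ^ 2)) := by gcongr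
    _ = (sq ^ 2) ^ 4 * (16 * ((sC ^ 2) * (sC ^ 2) * ((sT ^ 2) * ((sT ^ 2) * (sr ^ 2))) * (sz ^ 2) * (sS ^ 2))) := by ring
    _ ≤ (sq ^ 2) ^ 8 * (16 * ((sC ^ 2) * (sC ^ 2) * ((sT ^ 2) * ((sT ^ 2) * (sr ^ 2))) * (sz ^ 2) * (sS ^ 2))) := mul_le_mul_of_nonneg_right (pow_le_pow_right₀ hq (by norm_num)) (by positivity)
    _ = (16 * ((sq ^ 2) ^ 4 * (sC ^ 2) * ((sq ^ 2) ^ 4 * (sC ^ 2)) * ((sT ^ 2) * ((sT ^ 2) * (sr ^ 2))) * (sz ^ 2) * 1)) * (sS ^ 2) := by ring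

/-- [folklore] **THE (C2) POLYNOMIAL IS n-UNIFORM ON THE ROAD's SCALING**: with both weights' amplitude `C`, `c_E = q⁴·C`, the leg masses
`q²·X` (`lapU∘Cgh`, `Cgh∘lapU`), `q⁴·G` (`Cgh`), `ψ` (`lapU∘Cgh∘lapU`), `r` (`Rgt`), `e^δ ≤ E_δ`, `e^θ ≤ E_θ` and the lattice constant `Z ≤ q⁴·z₁`,
the bound of `CoframeWordsKfour.totMass_cofPairInf` (with `C′ = C`, `χ = q²·X`, `γ = q⁴·G`) is `≤ K·S` with `K` free of `q ≥ 1`: every monomial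
carries `C·C·Z = q⁻⁴·c_E²·z₁` against at most `q⁴` from the legs. -/
theorem poly_bound {q cE C X G ψ r eδ eθ Z S z₁ Eδ Eθ : ℝ} (hq : 1 ≤ q) (hC0 : 0 ≤ C) (hC : cE = q ^ 4 * C) (hX : 0 ≤ X) (hG : 0 ≤ G)
    (hψ : 0 ≤ ψ) (hr : 0 ≤ r) (heδ : 0 ≤ eδ) (heδE : eδ ≤ Eδ) (heθ : 0 ≤ eθ) (heθE : eθ ≤ Eθ) (hZ0 : 0 ≤ Z) (hZ : Z ≤ q ^ 4 * z₁) (hS : 0 ≤ S) :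
    |(2 : ℝ)| * (
        (64 * ((q ^ 2 * X) * (8 * ((C * C) * Z * S))) + 32 * ((q ^ 2 * X) * (8 * C * eδ) * eδ * C * Z * S) + 32 * ((q ^ 2 * X) * (8 * C * eδ) * eδ * C * Z * S) + 32 * (r * ((C *
          C) * Z * S))) + ((64 * (((q ^ 2 * X) * (8 * C * eδ)) * (8 * C * eδ) * (q ^ 2 * X) * Z * S) + 64 * ((ψ * (8 * C * eδ)) * (8 * C * eδ) * (q ^ 4 * G) * Z * S)) + (32 *
          (((q ^ 2 * X) * (8 * C * eδ)) * C * (eθ * ψ) * Z * S) + 32 * ((ψ * (8 * C * eδ)) * C * (eθ * (q ^ 2 * X)) * Z * S))) + ((64 * (((q ^ 2 * X) * (8 * C * eδ)) * (8 * C *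
          eδ) * (q ^ 2 * X) * Z * S) + 64 * ((ψ * (8 * C * eδ)) * (8 * C * eδ) * (q ^ 4 * G) * Z * S)) + (32 * (((q ^ 2 * X) * (8 * C * eδ)) * C * (eθ * ψ) * Z * S) + 32 * ((ψ *
          (8 * C * eδ)) * C * (eθ * (q ^ 2 * X)) * Z * S))) + (64 * ((q ^ 2 * X) * (8 * ((C * C) * Z * S)) * ψ + ((q ^ 2 * X) * (8 * C * eδ)) * (8 * C * eδ) * Z * S * (q ^ 2 *
          X) + ((q ^ 2 * X) * (8 * C * eδ)) * (8 * C * eδ) * Z * S * (q ^ 2 * X) + ψ * (8 * ((C * C) * Z * S)) * (q ^ 2 * X)) + 64 * ((((q ^ 2 * X) * (8 * C * eδ)) * (8 * C *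
          eδ) * (q ^ 2 * X) * Z * S * ψ + ((q ^ 2 * X) * (8 * C * eδ)) * (8 * C * eδ) * ψ * Z * S * (q ^ 2 * X)) + ((ψ * (8 * C * eδ)) * (8 * C * eδ) * (q ^ 4 * G) * Z * S * ψ +
          (ψ * (8 * C * eδ)) * (8 * C * eδ) * (q ^ 2 * X) * Z * S * (q ^ 2 * X))) + 64 * ((((q ^ 2 * X) * (8 * C * eδ)) * (8 * C * eδ) * (q ^ 2 * X) * Z * S * ψ + ((q ^ 2 * X) *
          (8 * C * eδ)) * (8 * C * eδ) * ψ * Z * S * (q ^ 2 * X)) + ((ψ * (8 * C * eδ)) * (8 * C * eδ) * (q ^ 4 * G) * Z * S * ψ + (ψ * (8 * C * eδ)) * (8 * C * eδ) * (q ^ 2 *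
          X) * Z * S * (q ^ 2 * X)))) + (64 * ((8 * C * eδ) * (8 * C * eδ) * (q ^ 4 * G) * Z * S) + 32 * ((8 * C * eδ) * C * (eθ * (q ^ 2 * X)) * Z * S) + 32 * ((8 * C * eδ) * C
          * (eθ * (q ^ 2 * X)) * Z * S) + 16 * (C * C * (eθ * (eθ * r)) * Z * S)) + (64 * ((8 * C * eδ) * (8 * C * eδ) * (q ^ 4 * G) * Z * S) + 32 * ((8 * C * eδ) * C * (eθ * (q
          ^ 2 * X)) * Z * S) + 32 * ((8 * C * eδ) * C * (eθ * (q ^ 2 * X)) * Z * S) + 16 * (C * C * (eθ * (eθ * r)) * Z * S)) + ((64 * (((q ^ 2 * X) * (8 * C * eδ)) * (8 * C *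
          eδ) * (q ^ 2 * X) * Z * S) + 64 * ((ψ * (8 * C * eδ)) * (8 * C * eδ) * (q ^ 4 * G) * Z * S)) + (32 * (((q ^ 2 * X) * (8 * C * eδ)) * C * (eθ * ψ) * Z * S) + 32 * ((ψ *
          (8 * C * eδ)) * C * (eθ * (q ^ 2 * X)) * Z * S))) + ((64 * (((q ^ 2 * X) * (8 * C * eδ)) * (8 * C * eδ) * (q ^ 2 * X) * Z * S) + 64 * ((ψ * (8 * C * eδ)) * (8 * C *
          eδ) * (q ^ 4 * G) * Z * S)) + (32 * (((q ^ 2 * X) * (8 * C * eδ)) * C * (eθ * ψ) * Z * S) + 32 * ((ψ * (8 * C * eδ)) * C * (eθ * (q ^ 2 * X)) * Z * S))) + (64 * ((q ^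
          2 * X) * (8 * ((C * C) * Z * S))) + 32 * ((q ^ 2 * X) * (8 * C * eδ) * eδ * C * Z * S) + 32 * ((q ^ 2 * X) * (8 * C * eδ) * eδ * C * Z * S) + 32 * (r * ((C * C) * Z *
          S))))
      ≤ (|(2 : ℝ)| * (
        (64 * (X * (8 * ((cE * cE) * z₁ * 1))) + 32 * (X * (8 * cE * Eδ) * Eδ * cE * z₁ * 1) + 32 * (X * (8 * cE * Eδ) * Eδ * cE * z₁ * 1) + 32 * (r * ((cE * cE) * z₁ * 1))) +
          ((64 * ((X * (8 * cE * Eδ)) * (8 * cE * Eδ) * X * z₁ * 1) + 64 * ((ψ * (8 * cE * Eδ)) * (8 * cE * Eδ) * G * z₁ * 1)) + (32 * ((X * (8 * cE * Eδ)) * cE * (Eθ * ψ) * z₁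
          * 1) + 32 * ((ψ * (8 * cE * Eδ)) * cE * (Eθ * X) * z₁ * 1))) + ((64 * ((X * (8 * cE * Eδ)) * (8 * cE * Eδ) * X * z₁ * 1) + 64 * ((ψ * (8 * cE * Eδ)) * (8 * cE * Eδ) *
          G * z₁ * 1)) + (32 * ((X * (8 * cE * Eδ)) * cE * (Eθ * ψ) * z₁ * 1) + 32 * ((ψ * (8 * cE * Eδ)) * cE * (Eθ * X) * z₁ * 1))) + (64 * (X * (8 * ((cE * cE) * z₁ * 1)) * ψ
          + (X * (8 * cE * Eδ)) * (8 * cE * Eδ) * z₁ * 1 * X + (X * (8 * cE * Eδ)) * (8 * cE * Eδ) * z₁ * 1 * X + ψ * (8 * ((cE * cE) * z₁ * 1)) * X) + 64 * (((X * (8 * cE *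
          Eδ)) * (8 * cE * Eδ) * X * z₁ * 1 * ψ + (X * (8 * cE * Eδ)) * (8 * cE * Eδ) * ψ * z₁ * 1 * X) + ((ψ * (8 * cE * Eδ)) * (8 * cE * Eδ) * G * z₁ * 1 * ψ + (ψ * (8 * cE *
          Eδ)) * (8 * cE * Eδ) * X * z₁ * 1 * X)) + 64 * (((X * (8 * cE * Eδ)) * (8 * cE * Eδ) * X * z₁ * 1 * ψ + (X * (8 * cE * Eδ)) * (8 * cE * Eδ) * ψ * z₁ * 1 * X) + ((ψ *
          (8 * cE * Eδ)) * (8 * cE * Eδ) * G * z₁ * 1 * ψ + (ψ * (8 * cE * Eδ)) * (8 * cE * Eδ) * X * z₁ * 1 * X))) + (64 * ((8 * cE * Eδ) * (8 * cE * Eδ) * G * z₁ * 1) + 32 *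
          ((8 * cE * Eδ) * cE * (Eθ * X) * z₁ * 1) + 32 * ((8 * cE * Eδ) * cE * (Eθ * X) * z₁ * 1) + 16 * (cE * cE * (Eθ * (Eθ * r)) * z₁ * 1)) + (64 * ((8 * cE * Eδ) * (8 * cE
          * Eδ) * G * z₁ * 1) + 32 * ((8 * cE * Eδ) * cE * (Eθ * X) * z₁ * 1) + 32 * ((8 * cE * Eδ) * cE * (Eθ * X) * z₁ * 1) + 16 * (cE * cE * (Eθ * (Eθ * r)) * z₁ * 1)) + ((64
          * ((X * (8 * cE * Eδ)) * (8 * cE * Eδ) * X * z₁ * 1) + 64 * ((ψ * (8 * cE * Eδ)) * (8 * cE * Eδ) * G * z₁ * 1)) + (32 * ((X * (8 * cE * Eδ)) * cE * (Eθ * ψ) * z₁ * 1)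
          + 32 * ((ψ * (8 * cE * Eδ)) * cE * (Eθ * X) * z₁ * 1))) + ((64 * ((X * (8 * cE * Eδ)) * (8 * cE * Eδ) * X * z₁ * 1) + 64 * ((ψ * (8 * cE * Eδ)) * (8 * cE * Eδ) * G *
          z₁ * 1)) + (32 * ((X * (8 * cE * Eδ)) * cE * (Eθ * ψ) * z₁ * 1) + 32 * ((ψ * (8 * cE * Eδ)) * cE * (Eθ * X) * z₁ * 1))) + (64 * (X * (8 * ((cE * cE) * z₁ * 1))) + 32 *
          (X * (8 * cE * Eδ) * Eδ * cE * z₁ * 1) + 32 * (X * (8 * cE * Eδ) * Eδ * cE * z₁ * 1) + 32 * (r * ((cE * cE) * z₁ * 1))))) * S := by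
  have hz₁ : 0 ≤ z₁ := by
    have h4 : 0 < q ^ 4 := by positivity
    nlinarith [hZ0.trans hZ]
  have hEδ : 0 ≤ Eδ := heδ.trans heδE
  have hEθ : 0 ≤ Eθ := heθ.trans heθE
  subst hC
  obtain ⟨sq, rfl⟩ : ∃ s : ℝ, q = s ^ 2 := ⟨Real.sqrt q, (Real.sq_sqrt (by linarith)).symm⟩
  obtain ⟨sC, rfl⟩ : ∃ s : ℝ, C = s ^ 2 := ⟨Real.sqrt C, (Real.sq_sqrt hC0).symm⟩
  obtain ⟨sX, rfl⟩ : ∃ s : ℝ, X = s ^ 2 := ⟨Real.sqrt X, (Real.sq_sqrt hX).symm⟩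
  obtain ⟨sG, rfl⟩ : ∃ s : ℝ, G = s ^ 2 := ⟨Real.sqrt G, (Real.sq_sqrt hG).symm⟩
  obtain ⟨sP, rfl⟩ : ∃ s : ℝ, ψ = s ^ 2 := ⟨Real.sqrt ψ, (Real.sq_sqrt hψ).symm⟩
  obtain ⟨sr, rfl⟩ : ∃ s : ℝ, r = s ^ 2 := ⟨Real.sqrt r, (Real.sq_sqrt hr).symm⟩
  obtain ⟨se, rfl⟩ : ∃ s : ℝ, eδ = s ^ 2 := ⟨Real.sqrt eδ, (Real.sq_sqrt heδ).symm⟩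
  obtain ⟨st, rfl⟩ : ∃ s : ℝ, eθ = s ^ 2 := ⟨Real.sqrt eθ, (Real.sq_sqrt heθ).symm⟩
  obtain ⟨sZ, rfl⟩ : ∃ s : ℝ, Z = s ^ 2 := ⟨Real.sqrt Z, (Real.sq_sqrt hZ0).symm⟩
  obtain ⟨sS, rfl⟩ : ∃ s : ℝ, S = s ^ 2 := ⟨Real.sqrt S, (Real.sq_sqrt hS).symm⟩
  obtain ⟨sz, rfl⟩ : ∃ s : ℝ, z₁ = s ^ 2 := ⟨Real.sqrt z₁, (Real.sq_sqrt hz₁).symm⟩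
  obtain ⟨sE, rfl⟩ : ∃ s : ℝ, Eδ = s ^ 2 := ⟨Real.sqrt Eδ, (Real.sq_sqrt hEδ).symm⟩
  obtain ⟨sT, rfl⟩ : ∃ s : ℝ, Eθ = s ^ 2 := ⟨Real.sqrt Eθ, (Real.sq_sqrt hEθ).symm⟩
  exact le_trans (mul_le_mul_of_nonneg_left
    (add_le_add (add_le_add (add_le_add (add_le_add (add_le_add (add_le_add (add_le_add (add_le_add (add_le_add (add_le_add (add_le_add (m1 sq sC sX sZ sS sz hq hZ) (m2
      sq sC sX se sZ sS sz sE hq heδE hZ)) (m2 sq sC sX se sZ sS sz sE hq heδE hZ)) (m3 sq sC sr sZ sS sz hq hZ)) (add_le_add (add_le_add (m4 sq sC sX se sZ sS sz sE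
      heδE hZ) (m5 sq sC sG sP se sZ sS sz sE heδE hZ)) (add_le_add (m6 sq sC sX sP se st sZ sS sz sE sT hq heδE heθE hZ) (m7 sq sC sX sP se st sZ sS sz sE sT hq heδE
      heθE hZ)))) (add_le_add (add_le_add (m4 sq sC sX se sZ sS sz sE heδE hZ) (m5 sq sC sG sP se sZ sS sz sE heδE hZ)) (add_le_add (m6 sq sC sX sP se st sZ sS sz sE sT
      hq heδE heθE hZ) (m7 sq sC sX sP se st sZ sS sz sE sT hq heδE heθE hZ)))) (add_le_add (add_le_add (mul_le_mul_of_nonneg_left (add_le_add (add_le_add (add_le_add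
      (m8 sq sC sX sP sZ sS sz hq hZ) (m9 sq sC sX se sZ sS sz sE heδE hZ)) (m9 sq sC sX se sZ sS sz sE heδE hZ)) (m10 sq sC sX sP sZ sS sz hq hZ)) (by norm_num))
      (mul_le_mul_of_nonneg_left (add_le_add (add_le_add (m11 sq sC sX sP se sZ sS sz sE heδE hZ) (m12 sq sC sX sP se sZ sS sz sE heδE hZ)) (add_le_add (m13 sq sC sG sP
      se sZ sS sz sE heδE hZ) (m14 sq sC sX sP se sZ sS sz sE heδE hZ))) (by norm_num))) (mul_le_mul_of_nonneg_left (add_le_add (add_le_add (m11 sq sC sX sP se sZ sS sz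
      sE heδE hZ) (m12 sq sC sX sP se sZ sS sz sE heδE hZ)) (add_le_add (m13 sq sC sG sP se sZ sS sz sE heδE hZ) (m14 sq sC sX sP se sZ sS sz sE heδE hZ))) (by
      norm_num)))) (add_le_add (add_le_add (add_le_add (m15 sq sC sG se sZ sS sz sE heδE hZ) (m16 sq sC sX se st sZ sS sz sE sT hq heδE heθE hZ)) (m16 sq sC sX se st sZ
      sS sz sE sT hq heδE heθE hZ)) (m17 sq sC sr st sZ sS sz sT hq heθE hZ))) (add_le_add (add_le_add (add_le_add (m15 sq sC sG se sZ sS sz sE heδE hZ) (m16 sq sC sX se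
      st sZ sS sz sE sT hq heδE heθE hZ)) (m16 sq sC sX se st sZ sS sz sE sT hq heδE heθE hZ)) (m17 sq sC sr st sZ sS sz sT hq heθE hZ))) (add_le_add (add_le_add (m4 sq
      sC sX se sZ sS sz sE heδE hZ) (m5 sq sC sG sP se sZ sS sz sE heδE hZ)) (add_le_add (m6 sq sC sX sP se st sZ sS sz sE sT hq heδE heθE hZ) (m7 sq sC sX sP se st sZ
      sS sz sE sT hq heδE heθE hZ)))) (add_le_add (add_le_add (m4 sq sC sX se sZ sS sz sE heδE hZ) (m5 sq sC sG sP se sZ sS sz sE heδE hZ)) (add_le_add (m6 sq sC sX sP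
      se st sZ sS sz sE sT hq heδE heθE hZ) (m7 sq sC sX sP se st sZ sS sz sE sT hq heδE heθE hZ)))) (add_le_add (add_le_add (add_le_add (m1 sq sC sX sZ sS sz hq hZ) (m2
      sq sC sX se sZ sS sz sE hq heδE hZ)) (m2 sq sC sX se sZ sS sz sE hq heδE hZ)) (m3 sq sC sr sZ sS sz hq hZ)))
    (abs_nonneg _)) (le_of_eq (by ring))

end Summit.QuantumFields.BalabanUV.Beta.D1BFx.CoframeMassAlgebra
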